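import Mathlib
import Summits.ResolutionOfSingularities.ResolutionOfSingularities.Theorems.WildQuotientsWildQuotientResolutionPthConeDefs
import Summits.ResolutionOfSingularities.ResolutionOfSingularities.Theorems.WildQuotientsWildQuotientResolutionJordanThreeChartsA
import Summits.ResolutionOfSingularities.ResolutionOfSingularities.Theorems.WildQuotientsWildQuotientResolutionToricChartLemmas
import Summits.ResolutionOfSingularities.ResolutionOfSingularities.Theorems.WildQuotientsWildQuotientResolutionThirdConeChartCube

/-!
# Symbolic toric chart engine for the `μ_p` cones: a dual basis makes a vertex chart an affine space
(crux stmt-ResolutionOfSingularities-15640 `WildQuotients.WildQuotientResolution`, line `Sketch`;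
chain w45c POST-V5 S2 = the conductor-𝟙 core `ConductorOneCore p n` of bricks, brick F6
`…ConductorOneToricFan` = the toric brick `T(a,b)` of res-L1-w45c-lead-1's `S2-DESIGN.md` §3 («charts:
k[S][𝔞/x^{m_τ}] = k[τ^∨ ∩ M] = polynomial ring in the dual basis (regular)») / §7 (7.6), res-L1-w45c-plan-1
RULING 2026-08-27T17:07:17Z. [OURS · L1 W4.5c] — NOT a statement of any manuscript; replaces the role of
no printed item. Owner res-L1-w45c-stub-4 (gen 5).)

This is the ENGINE of F6, generic in the monomial centre: it is the mould
`PthCone.isRegularRing_chartRing_purePow` (…PthConeVeroneseChart, stub-4 g4 ← stub-2's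
`ThirdCone.isRegularRing_chartRing_cube`) with the Veronese dual basis replaced by an ABSTRACT one, so that
the three vertex types of the fan `Σ_{a,b}` (two ends, middle) are instances and the proof is uniform in
`p`. Data at the chart `D₊(x^{m_τ} t)` of `Bl_𝔞 Spec (cone k n p w)`, `𝔞 = (c_0,…,c_{N−1})` monomial:
scaled ray functionals `Λ_l : ℤⁿ → ℤ` (`= p·⟨ray_l, ·⟩`) and dual vectors `ε_l ∈ ℤⁿ` with
* duality `p·m = Σ_l Λ_l(m) ε_l`, biorthogonality `Λ_{l'}(ε_l) = p δ_{l l'}`;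
* `Λ_l` is divisible by `p` on weight-`0` exponents and non-negative on `ℕⁿ` (the rays lie in the cone);
* the «vertex + dual vector» monomials `x^{m_τ + ε_l}` are among the generators (edge generators);
* every generator `x^{m}` satisfies `Λ_l(m_τ) ≤ Λ_l(m)` (the vertex minimises the rays of its cone on the
  Newton polyhedron).
Conclusion `PthCone.isRegularRing_chartRing_of_dualBasis`: the chart ring is the polynomial ring
`k[x^{ε_1},…,x^{ε_n}]`, in particular regular. Proof: chart map `φ : k[Y] → cone[1/x^{m_τ}]`,
`Y_l ↦ x^{m_τ+ε_l}/x^{m_τ}`; values in the blow-up algebra (I); the core identity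
`x^d · (x^{m_τ})^N = (x^{m_τ})^t · ∏_l (x^{m_τ+ε_l})^{n_l}`, `p n_l = Λ_l(d) − tΛ_l(m_τ)`, gives the cone
(`t = 0`) and the fractions `c_i/x^{m_τ}` (`t = 1`) in the range (II, III); injectivity through the Laurent
ring by `ToricChart.aeval_laurentMonomial_injective` and biorthogonality (IV); then
`JordanThree.range_eq_blowupAlgebra_of_chart` / `isRegularRing_chartRing_of_chart`. No notation.
-/

set_option linter.dupNamespace false

noncomputable section

open MvPolynomial IsLocalization AlgebraicGeometry
open Literature.AlgebraicGeometry.Resolution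

namespace Summit.ResolutionOfSingularities.ResolutionOfSingularities.Theorems.WildQuotientResolution.PthCone

universe u

variable (k : Type) [Field k] (n p : ℕ) (w : Fin n → ZMod p)

/-- The exponent of a monomial of the cone has weight `0`. [OURS · L1 W4.5c] -/
theorem weight_eq_zero_of_coe_eq_monomial (x : cone k n p w) (d : Fin n →₀ ℕ)
    (hx : (x : MvPolynomial (Fin n) k) = monomial d 1) : Finsupp.weight w d = 0 := by
  classical
  exact x.2 (by rw [hx, coeff_monomial, if_pos rfl]; exact one_ne_zero)

/-- The integer exponent vector `Σ_s d_s 𝐞_s ∈ ℤⁿ` of `d ∈ ℕⁿ` as a finitely supported function equals the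
coordinatewise cast. [folklore] -/
theorem sum_smul_single_eq (d : Fin n →₀ ℕ) :
    (∑ s, d s • Finsupp.single s (1 : ℤ)) = Finsupp.equivFunOnFinite.symm (fun i => (d i : ℤ)) := by
  classical
  ext i
  rw [Finsupp.finsetSum_apply, Finset.sum_eq_single i (fun s _ hs => by
    rw [Finsupp.smul_apply, Finsupp.single_apply, if_neg hs, smul_zero]) (fun h => absurd (Finset.mem_univ i) h)]
  simp

/-- `toLaurent (x^d)` is the Laurent monomial of `d`. [folklore] -/
theorem toLaurent_monomial (d : Fin n →₀ ℕ) :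
    ToricChart.toLaurent k (Fin n) (monomial d (1 : k)) =
      AddMonoidAlgebra.single (Finsupp.equivFunOnFinite.symm (fun i => (d i : ℤ))) (1 : k) := by
  rw [ThirdCone.monomial_one_eq_prod_X_pow, ToricChart.toLaurent_prod_X_pow, sum_smul_single_eq]

-- many small identities in the localisation; the proof is an explicit chart map
set_option maxHeartbeats 1600000 in
/-- **Symbolic toric vertex chart.** Let `𝔞 = (c_0,…,c_{N−1})` be a monomial ideal of the cone
`(1/p)(w)` and `c_j = x^{m_τ}` a vertex with scaled ray functionals `Λ_l` and dual vectors `ε_l`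
(duality, biorthogonality, divisibility on weight-`0` exponents, non-negativity), edge generators
`c_{edge l} = x^{m_τ + ε_l}`, and `Λ_l(m_τ) ≤ Λ_l(m)` for every generator `x^m`. Then the chart ring
`(cone[𝔞t])_{(x^{m_τ} t)}` is a polynomial ring in `n` variables, in particular regular.
[OURS · L1 W4.5c] -/
theorem isRegularRing_chartRing_of_dualBasis {N : ℕ} (c : Fin N → cone k n p w) (j : Fin N) (hp : 0 < p)
    (mτ : Fin n →₀ ℕ) (hcj : ((c j : cone k n p w) : MvPolynomial (Fin n) k) = monomial mτ 1)
    (Λ : Fin n → ((Fin n → ℤ) →+ ℤ)) (ε : Fin n → Fin n → ℤ)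
    (hdual : ∀ (m : Fin n → ℤ) (i : Fin n), (p : ℤ) * m i = ∑ l, Λ l m * ε l i)
    (hbi : ∀ l l' : Fin n, Λ l' (ε l) = if l = l' then (p : ℤ) else 0)
    (hdiv : ∀ d : Fin n →₀ ℕ, Finsupp.weight w d = 0 → ∀ l, (p : ℤ) ∣ Λ l (fun i => (d i : ℤ)))
    (hpos : ∀ (d : Fin n →₀ ℕ) (l : Fin n), 0 ≤ Λ l (fun i => (d i : ℤ)))
    (edge : Fin n → Fin N) (eε : Fin n → (Fin n →₀ ℕ))
    (hedge : ∀ l, ((c (edge l) : cone k n p w) : MvPolynomial (Fin n) k) = monomial (eε l) 1)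
    (hε : ∀ l i, ((eε l i : ℕ) : ℤ) = (mτ i : ℤ) + ε l i)
    (hgen : ∀ i : Fin N, ∃ d : Fin n →₀ ℕ,
      ((c i : cone k n p w) : MvPolynomial (Fin n) k) = monomial d 1 ∧
        ∀ l, Λ l (fun i => (mτ i : ℤ)) ≤ Λ l (fun i => (d i : ℤ))) :
    IsRegularRing (chartRing c j) := by
  classical
  -- notation
  let g : cone k n p w := c j
  let L := Localization.Away g
  let am : cone k n p w →+* L := algebraMap _ L
  let ι : L := IsLocalization.Away.invSelf g
  have hinv : am g * ι = 1 := IsLocalization.Away.mul_invSelf (S := L) g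
  haveI : IsRegularRing (MvPolynomial (Fin n) k) := MvPolynomial.isRegularRing_of_isRegularRing k
  have hp0 : (p : ℤ) ≠ 0 := by exact_mod_cast hp.ne'
  have hwτ : Finsupp.weight w mτ = 0 := weight_eq_zero_of_coe_eq_monomial k n p w _ _ hcj
  -- the chart map `φ : Y_l ↦ c_{edge l} / g`
  let v : Fin n → L := fun l => am (c (edge l)) * ι
  let φ : MvPolynomial (Fin n) k →ₐ[k] L := aeval v
  have hφX : ∀ l, φ (X l) = am (c (edge l)) * ι := fun l => by simp [φ, v]
  have hφC : ∀ r : k, φ (C r) = am (algebraMap k (cone k n p w) r) := fun r => by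
    rw [aeval_C, IsScalarTower.algebraMap_apply k (cone k n p w) L]
  -- (I) values in the blow-up algebra
  have hmem : ∀ x, (φ : MvPolynomial (Fin n) k →+* L) x ∈
      blowupAlgebra (Ideal.span (Set.range c)) (c j) := by
    intro x
    induction x using MvPolynomial.induction_on with
    | C r => rw [RingHom.coe_coe, hφC]; exact Subalgebra.algebraMap_mem _ _
    | add p q hp hq => rw [map_add]; exact Subalgebra.add_mem _ hp hq
    | mul_X q l hq =>
      rw [map_mul]
      refine Subalgebra.mul_mem _ hq ?_
      rw [RingHom.coe_coe, hφX]
      exact div_mem_blowupAlgebra _ _ (Ideal.subset_span ⟨edge l, rfl⟩)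
  -- (CORE) the monomial identity behind (II) and (III)
  have core : ∀ (d : Fin n →₀ ℕ) (hd : Finsupp.weight w d = 0) (t : ℕ),
      (∀ l, (t : ℤ) * Λ l (fun i => (mτ i : ℤ)) ≤ Λ l (fun i => (d i : ℤ))) →
      ∃ P : MvPolynomial (Fin n) k,
        φ P = am ⟨monomial d 1, monomial_mem_cone k n p w hd 1⟩ * ι ^ t := by
    intro d hd t ht
    -- the exponents `n_l`, `p n_l = Λ_l(d) − t Λ_l(m_τ)`
    have hq : ∀ l, ∃ q : ℕ, (p : ℤ) * q =
        Λ l (fun i => (d i : ℤ)) - t * Λ l (fun i => (mτ i : ℤ)) := by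
      intro l
      have hdv : (p : ℤ) ∣ Λ l (fun i => (d i : ℤ)) - t * Λ l (fun i => (mτ i : ℤ)) :=
        dvd_sub (hdiv d hd l) (dvd_mul_of_dvd_right (hdiv mτ hwτ l) _)
      obtain ⟨q, hq⟩ := hdv
      have hq0 : 0 ≤ q := by
        have h0 : 0 ≤ (p : ℤ) * q := by rw [← hq]; linarith [ht l]
        exact nonneg_of_mul_nonneg_right (by rwa [mul_comm] at h0) (by exact_mod_cast hp)
      exact ⟨q.toNat, by rw [Int.toNat_of_nonneg hq0, hq]⟩
    choose nn hnn using hq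
    -- the exponent identity `d + N m_τ = t m_τ + Σ n_l (m_τ + ε_l)`
    have key : ∀ i, (d i : ℤ) = t * (mτ i : ℤ) + ∑ l, (nn l : ℤ) * ε l i := by
      intro i
      have h1 := hdual (fun i => (d i : ℤ)) i
      have h2 := hdual (fun i => (mτ i : ℤ)) i
      have h3 : (p : ℤ) * ∑ l, (nn l : ℤ) * ε l i =
          (∑ l, Λ l (fun i => (d i : ℤ)) * ε l i) - t * ∑ l, Λ l (fun i => (mτ i : ℤ)) * ε l i := by
        rw [Finset.mul_sum, Finset.mul_sum, ← Finset.sum_sub_distrib]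
        refine Finset.sum_congr rfl fun l _ => ?_
        rw [← mul_assoc, hnn l]
        ring
      apply mul_left_cancel₀ hp0
      linear_combination h1 - (t : ℤ) * h2 - h3
    have hexp : d + (∑ l, nn l) • mτ = t • mτ + ∑ l, nn l • eε l := by
      ext i
      simp only [Finsupp.add_apply, Finsupp.smul_apply, smul_eq_mul, Finsupp.finsetSum_apply]
      have : (d i : ℤ) + ((∑ l, nn l : ℕ) : ℤ) * mτ i = t * mτ i + ∑ l, ((nn l : ℤ) * (eε l i : ℤ)) := by
        simp_rw [hε, mul_add, Finset.sum_add_distrib, ← Finset.sum_mul]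
        rw [key i]
        push_cast
        ring
      exact_mod_cast this
    -- the identity in the cone
    have hcone : (⟨monomial d 1, monomial_mem_cone k n p w hd 1⟩ : cone k n p w) * g ^ (∑ l, nn l) =
        g ^ t * ∏ l, c (edge l) ^ nn l := by
      apply Subtype.ext
      simp only [Subalgebra.coe_mul, Subalgebra.coe_pow, SubmonoidClass.coe_finsetProd]
      rw [show ((g : cone k n p w) : MvPolynomial (Fin n) k) = monomial mτ 1 from hcj]
      simp_rw [hedge, monomial_pow, one_pow, monomial_mul, one_mul, ← monomial_sum_one, monomial_mul,
        one_mul]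
      rw [hexp]
    -- transfer to the localisation
    have hL := congrArg am hcone
    simp only [map_mul, map_pow, map_prod] at hL
    refine ⟨∏ l, X l ^ nn l, ?_⟩
    rw [map_prod]
    simp_rw [map_pow, hφX]
    simp_rw [mul_pow]
    rw [Finset.prod_mul_distrib, Finset.prod_pow_eq_pow_sum]
    calc (∏ l, am (c (edge l)) ^ nn l) * ι ^ (∑ l, nn l)
        = (am g * ι) ^ t * ((∏ l, am (c (edge l)) ^ nn l) * ι ^ (∑ l, nn l)) := by
          rw [hinv, one_pow, one_mul]
      _ = (am g ^ t * ∏ l, am (c (edge l)) ^ nn l) * ι ^ t * ι ^ (∑ l, nn l) := by ring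
      _ = (am ⟨monomial d 1, monomial_mem_cone k n p w hd 1⟩ * am g ^ (∑ l, nn l)) * ι ^ t *
            ι ^ (∑ l, nn l) := by rw [hL]
      _ = am ⟨monomial d 1, monomial_mem_cone k n p w hd 1⟩ * ι ^ t * (am g * ι) ^ (∑ l, nn l) := by
          ring
      _ = am ⟨monomial d 1, monomial_mem_cone k n p w hd 1⟩ * ι ^ t := by
          rw [hinv, one_pow, mul_one]
  -- (II) the cone lies in the range
  have hmono : ∀ (e : Fin n →₀ ℕ) (he : Finsupp.weight w e = 0),
      am ⟨monomial e 1, monomial_mem_cone k n p w he 1⟩ ∈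
        Set.range (φ : MvPolynomial (Fin n) k →+* L) := by
    intro e he
    obtain ⟨P, hP⟩ := core e he 0 (fun l => by rw [Nat.cast_zero, zero_mul]; exact hpos e l)
    exact ⟨P, by rw [RingHom.coe_coe, hP, pow_zero, mul_one]⟩
  have hbase : ∀ r : cone k n p w, am r ∈ Set.range (φ : MvPolynomial (Fin n) k →+* L) := by
    rintro ⟨f, hf⟩
    let μ : (Fin n →₀ ℕ) → cone k n p w := fun e =>
      if he : Finsupp.weight w e = 0 then ⟨monomial e 1, monomial_mem_cone k n p w he 1⟩ else 0
    have hμ : ∀ (e) (he : e ∈ f.support), μ e = ⟨monomial e 1,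
        monomial_mem_cone k n p w (hf (Finsupp.mem_support_iff.mp he)) 1⟩ := by
      intro e he
      have hwe : Finsupp.weight w e = 0 := hf (Finsupp.mem_support_iff.mp he)
      simp [μ, hwe]
    have hdec : (⟨f, hf⟩ : cone k n p w) = ∑ e ∈ f.support, coeff e f • μ e := by
      apply Subtype.ext
      change f = ((∑ e ∈ f.support, coeff e f • μ e : cone k n p w) : MvPolynomial (Fin n) k)
      rw [AddSubmonoidClass.coe_finsetSum]
      conv_lhs => rw [f.as_sum]
      refine Finset.sum_congr rfl fun e he => ?_
      rw [Subalgebra.coe_smul, hμ e he, smul_monomial, smul_eq_mul, mul_one]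
    rw [hdec, map_sum]
    have hmemR : ∀ e ∈ f.support, am (coeff e f • μ e) ∈ φ.range := by
      intro e he
      have hsm : am (coeff e f • μ e) = algebraMap k L (coeff e f) * am (μ e) := by
        rw [Algebra.smul_def, map_mul, IsScalarTower.algebraMap_apply k (cone k n p w) L]
      rw [hsm]
      refine Subalgebra.mul_mem _ (Subalgebra.algebraMap_mem _ _) ?_
      rw [hμ e he]
      obtain ⟨Q, hQ⟩ := hmono e (hf (Finsupp.mem_support_iff.mp he))
      exact φ.mem_range.mpr ⟨Q, hQ⟩
    exact φ.mem_range.mp (Subalgebra.sum_mem _ hmemR)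
  -- (III) the fractions `c_i / g` lie in the range
  have hgen' : ∀ i, am (c i) * ι ∈ Set.range (φ : MvPolynomial (Fin n) k →+* L) := by
    intro i
    obtain ⟨d, hcd, hle⟩ := hgen i
    have hd : Finsupp.weight w d = 0 := weight_eq_zero_of_coe_eq_monomial k n p w _ _ hcd
    obtain ⟨P, hP⟩ := core d hd 1 (fun l => by rw [Nat.cast_one, one_mul]; exact hle l)
    have hci : c i = ⟨monomial d 1, monomial_mem_cone k n p w hd 1⟩ := Subtype.ext hcd
    exact ⟨P, by rw [RingHom.coe_coe, hP, pow_one, hci]⟩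
  -- (IV) injectivity through the Laurent ring
  let Lau := ToricChart.Laurent k (Fin n)
  let T : cone k n p w →+* Lau :=
    (ToricChart.toLaurent k (Fin n)).toRingHom.comp (cone k n p w).val.toRingHom
  have hT : ∀ r : cone k n p w, T r = ToricChart.toLaurent k (Fin n) (r : MvPolynomial (Fin n) k) :=
    fun r => rfl
  let zv : (Fin n → ℤ) → (Fin n →₀ ℤ) := fun f => Finsupp.equivFunOnFinite.symm f
  have hTg : T g = AddMonoidAlgebra.single (zv fun i => (mτ i : ℤ)) (1 : k) := by
    rw [hT, show ((g : cone k n p w) : MvPolynomial (Fin n) k) = monomial mτ 1 from hcj,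
      toLaurent_monomial]
  have hunit : IsUnit (T g) := by rw [hTg]; exact ToricChart.isUnit_single _
  let Θ : L →+* Lau := IsLocalization.Away.lift g hunit
  have hΘam : ∀ r, Θ (am r) = T r := fun r => IsLocalization.Away.lift_eq g hunit r
  have hΘι : Θ ι = AddMonoidAlgebra.single (-(zv fun i => (mτ i : ℤ))) (1 : k) := by
    have h : T g * Θ ι = 1 := by rw [← hΘam, ← map_mul, hinv, map_one]
    calc Θ ι = Θ ι * (AddMonoidAlgebra.single (zv fun i => (mτ i : ℤ)) (1 : k) *
          AddMonoidAlgebra.single (-(zv fun i => (mτ i : ℤ))) (1 : k)) := by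
            rw [ToricChart.single_mul_single_neg, mul_one]
      _ = (T g * Θ ι) * AddMonoidAlgebra.single (-(zv fun i => (mτ i : ℤ))) (1 : k) := by
            rw [hTg]; ring
      _ = _ := by rw [h, one_mul]
  have hΘφX : ∀ l, Θ (φ (X l)) = AddMonoidAlgebra.single (zv (ε l)) (1 : k) := by
    intro l
    rw [hφX, map_mul, hΘam, hT, hedge, toLaurent_monomial, hΘι, AddMonoidAlgebra.single_mul_single,
      mul_one]
    congr 1
    ext i
    simp only [zv, Finsupp.coe_add, Finsupp.coe_neg, Pi.add_apply, Pi.neg_apply,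
      Finsupp.coe_equivFunOnFinite_symm, hε]
    ring
  have hcomp : Θ.comp (φ : MvPolynomial (Fin n) k →+* L) =
      (MvPolynomial.aeval (R := k) (S₁ := Lau) fun l => AddMonoidAlgebra.single (zv (ε l)) (1 : k) :
        MvPolynomial (Fin n) k →+* Lau) := by
    refine MvPolynomial.ringHom_ext (fun r => ?_) (fun l => ?_)
    · rw [RingHom.comp_apply, RingHom.coe_coe, hφC, hΘam, hT, Subalgebra.coe_algebraMap,
        RingHom.coe_coe, aeval_C, AlgHom.commutes]
    · rw [RingHom.comp_apply, RingHom.coe_coe, hΘφX, RingHom.coe_coe, aeval_X]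
  have hB : Function.Injective (fun e : Fin n →₀ ℕ => e.sum fun v m => (m : ℤ) • zv (ε v)) := by
    intro e e' h
    ext l'
    let Λ' : (Fin n →₀ ℤ) →+ ℤ := (Λ l').comp Finsupp.coeFnAddHom
    have hΛ' : ∀ e : Fin n →₀ ℕ, Λ' (e.sum fun v m => (m : ℤ) • zv (ε v)) = p * e l' := by
      intro e
      rw [map_finsuppSum, Finsupp.sum_fintype _ _ (fun v => by simp)]
      simp only [map_zsmul, smul_eq_mul]
      have hv : ∀ v, Λ' (zv (ε v)) = if v = l' then (p : ℤ) else 0 := fun v => by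
        rw [← hbi v l']
        show Λ l' ⇑(Finsupp.equivFunOnFinite.symm (ε v)) = _
        rw [Finsupp.coe_equivFunOnFinite_symm]
      simp_rw [hv, mul_ite, mul_zero]
      rw [Finset.sum_ite_eq' Finset.univ l', if_pos (Finset.mem_univ _), mul_comm]
    have h1 := congrArg Λ' h
    simp only at h1
    rw [hΛ', hΛ'] at h1
    exact_mod_cast mul_left_cancel₀ hp0 h1
  have hinj : Function.Injective (φ : MvPolynomial (Fin n) k →+* L) := by
    have h := ToricChart.aeval_laurentMonomial_injective (k := k) (fun l => zv (ε l)) hB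
    intro p₁ q₁ hpq
    have h1 : Θ.comp (φ : MvPolynomial (Fin n) k →+* L) p₁ = Θ.comp (φ : MvPolynomial (Fin n) k →+* L) q₁ := by
      rw [RingHom.comp_apply, RingHom.comp_apply, hpq]
    rw [hcomp] at h1
    exact h h1
  -- conclusion
  have hrange := JordanThree.range_eq_blowupAlgebra_of_chart c j
    (φ : MvPolynomial (Fin n) k →+* L) hmem hbase hgen'
  exact JordanThree.isRegularRing_chartRing_of_chart c j (φ : MvPolynomial (Fin n) k →+* L) hinj hrange

end Summit.ResolutionOfSingularities.ResolutionOfSingularities.Theorems.WildQuotientResolution.PthCone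

end
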